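import Summits.Ventures.Crystal3D.Theorems.StickyWulffConstantTextureBuildMeshV2
import HarnessLib

/-!
# TB-1: the LABELLED POLYHEDRAL MESH v3 — polyhedral fiat-solid CORES and polygonal PRISM texture-cells (what the texture assembly TB-D can consume)
# (lane T, crux `TextureLiminfV5`, stmt-Ventures-23912; design memo HOME/wulff-p2/g19/TB-D-0.md §1 (O1)/(O2); cf-p1 DECISION (cliii) «interface v3», TB-1-g19)

HONEST FRAMING. Venture `Summits/Ventures/Crystal3D` (cell `crystal3d-full`), route `route-Ventures-StickyWulffConstant`, helper `--supports` the
law-v5 crux `TextureLiminfV5` (stmt-Ventures-23912).  DEFINITIONS (the part-2 interface, v3) + one composition by pure logic (census-free, standard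
axioms).  No mesh is constructed, no texture is built; rung F-C1 not moved.

WHY v3 (TB-D-0 §1).  The texture assembly computes `energy` and `vol` with `PolytopeCalculus` (A)+(B), i.e. for EXHIBITED finite disjoint families of
bounded open H-polytopes.  Two pieces of `Mesh₂` (…TextureBuildMeshV2, p708699) are not polyhedral as sets:
(O1) the free zone `U f = D f ∖ (round √2-collars of the cells)` together with the fiat-solid interior of FINDING M makes
     `texture_f := (D f ∖ U f) ∪ (G_f ∩ U f)` a set with no exhibited polytope decomposition.  v3: each grain carries a polyhedral CORE
     `Core f = ⋃_j polytope (HC f j) ⊆ D f` (the fiat-solid part), containing the part of `D f` within `√2` of the texture cells (so owned tent balls never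
     meet cell balls), and `U f := D f ∖ closure (Core f)`; `hcollar₃` asks tent solidity on the part of `U f` within `1` of the core; a core never reaches
     an EMPTY frontier point (folded into `hbdry`).  Then `texture_f = Core f ∪ (G_f ∩ D f) ∪ …` is a polytope family.
(O2) the texture piece of a wall cell cannot be the ROUND placed cylinder `Z k` (curved lateral surface).  v3: each cell carries a placed polygonal PRISM
     `P k = polytope (HP k) ⊇ Z k`; prisms are pairwise disjoint and disjoint from territories, gap pieces and riser boxes; territories WRAP THE PRISM; the
     law still certifies the round disc while the texture pays the cut polygon, the difference being at most `(13/25)·(area(polygon) − πρ²)` per cell: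
     fields `ex k` (`volume (P k ∩ unit slice) ≤ πρ_k² + ex k`) and `latArea k` (facet-area sum of the designated LATERAL facets `latP k ⊆ HP k`);
     `gapCost := 3·(gapArea + Σ_k latArea k) + (13/25)·Σ_k ex k` (replaces v1/v2's `2πρ(h+4R₀+2)` booking).
Everything else is `Mesh₂` verbatim with `Z k` replaced by `closure (P k)` in the wrap / side / disjointness / matching clauses and `Zlow/Zhigh` by the
prism's deep parts (`height ≤ −1` / `≥ h+1`).
THE COMPOSITION `shadowTheoremSatAtomicV5_of_risered₃_slack` / `textureBuildR₃_of_stubs`: as in v2 with `Mesh₃` and its `gapCost` — the shapes against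
which `stub_TB_cover` / `stub_TB_energy` should be registered (v8.8).
WHAT THIS IS NOT: no mesh is exhibited; FINDING V (near-wall opposite-family crossings; pending the pieced-plate lemma) is not addressed here; F-C1 not moved.
-/
noncomputable section

open scoped BigOperators InnerProductSpace ENNReal
open MeasureTheory

namespace Summit.Ventures.Crystal3D.Cruxes.TextureLiminf.TexShadow

open Summit.Ventures.Crystal3D Summit.Ventures.Crystal3D.Theorems Finset
open Literature.MathematicalPhysics.StatisticalMechanics (IsHaggSeq fccStacking barlowStacking contactDeficiency)


open scoped Classical in
/-- **THE LABELLED POLYHEDRAL MESH v3 of a risered cover** (polyhedral cores, prism texture-cells). -/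
structure Mesh₃ {C R₀ : ℝ} {N : ℕ} {x : Fin N → E3} (rc : RiseredCover C R₀ N x) (δ : ℝ) where
  /-- territories: finite unions of bounded open H-polytopes with unit normals -/
  nD : Fin rc.ng → ℕ
  HD : (f : Fin rc.ng) → Fin (nD f) → Finset (E3 × ℝ)
  hDbd : ∀ f j, Bornology.IsBounded (polytope (HD f j))
  hDunit : ∀ f j, ∀ p ∈ HD f j, ‖p.1‖ = 1
  /-- designated territory facets -/
  desD : (f : Fin rc.ng) → Fin (nD f) → Finset (E3 × ℝ)
  hdesD : ∀ f j, desD f j ⊆ HD f j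
  /-- polyhedral fiat-solid CORES, one family per grain, inside the territory -/
  nC : Fin rc.ng → ℕ
  HC : (f : Fin rc.ng) → Fin (nC f) → Finset (E3 × ℝ)
  hCbd : ∀ f j, Bornology.IsBounded (polytope (HC f j))
  hCunit : ∀ f j, ∀ p ∈ HC f j, ‖p.1‖ = 1
  hCD : ∀ f j, polytope (HC f j) ⊆ ⋃ j', polytope (HD f j')
  /-- polygonal PRISM texture-cells, one per wall cell, containing the round law cylinder -/
  HP : Fin rc.nk → Finset (E3 × ℝ)
  hPbd : ∀ k, Bornology.IsBounded (polytope (HP k))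
  hPunit : ∀ k, ∀ p ∈ HP k, ‖p.1‖ = 1
  hPZ : ∀ k, rc.Z k ⊆ closure (polytope (HP k))
  /-- designated lateral facets of the prisms and their area budget -/
  latP : Fin rc.nk → Finset (E3 × ℝ)
  hlatP : ∀ k, latP k ⊆ HP k
  latArea : Fin rc.nk → ℝ
  hlatArea : ∀ k, ∑ p ∈ latP k, facetArea (facetOf (HP k) p) p.1 ≤ latArea k
  /-- slice excess of the prism over the disc: the texture pays the polygon, the law certifies the disc -/
  ex : Fin rc.nk → ℝ
  hex : ∀ k, (volume (polytope (HP k) ∩ {y | 0 ≤ rc.height k y ∧ rc.height k y ≤ 1})).toReal ≤ Real.pi * (rc.cell k).ρ ^ 2 + ex k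
  /-- the part of a territory within `√2` of a prism lies in the closed core (owned tent balls never meet cell balls) -/
  hCZ : ∀ f, ∀ y ∈ (⋃ j, polytope (HD f j)), (∃ k, Metric.infDist y (closure (polytope (HP k))) ≤ Real.sqrt 2) →
    y ∈ closure (⋃ j, polytope (HC f j))
  /-- the free zone is the territory minus the closed core (POLYHEDRAL) -/
  hU : ∀ f, (rc.tent f).U = (⋃ j, polytope (HD f j)) \ closure (⋃ j, polytope (HC f j))
  /-- collar solidity: the part of the free zone within `1` of the core is tent-solid (the core itself is solid by fiat) -/
  hcollar₃ : ∀ f, ∀ z ∈ (rc.tent f).U, Metric.infDist z (⋃ j, polytope (HC f j)) < 1 → rc.SolidAt f z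
  /-- cells ↔ grains -/
  fk : Fin rc.nk → Fin rc.ng
  gk : Fin rc.nk → Fin rc.ng
  hfg : ∀ k, fk k ≠ gk k
  /-- gap pieces with grain labels -/
  nQ : ℕ
  HQ : Fin nQ → Finset (E3 × ℝ)
  lab : Fin nQ → Fin rc.ng
  /-- RISER BOXES, one per riser piece of the cover -/
  HB : Fin rc.nr → Finset (E3 × ℝ)
  hBbd : ∀ r, Bornology.IsBounded (polytope (HB r))
  hBunit : ∀ r, ∀ p ∈ HB r, ‖p.1‖ = 1
  desB : Fin rc.nr → Finset (E3 × ℝ)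
  hdesB : ∀ r, desB r ⊆ HB r
  /-- the territory boundary: EMPTY, or DESIGNATED, or matched with `f`-material across (deep cell halves, gap pieces, riser boxes carrying `f`,
  another territory in solid agreement); tent solidity is asked only on the free-zone part of the neighbourhood -/
  hbdry : ∀ f, ∀ y ∈ frontier (⋃ j, polytope (HD f j)),
    (rc.EmptyAt f y ∧ y ∉ closure (⋃ j, polytope (HC f j))) ∨ (∃ j, ∃ p ∈ desD f j, y ∈ facetOf (HD f j) p) ∨
      ∃ r : ℝ, 0 < r ∧ (∀ z ∈ Metric.ball y r, z ∈ (rc.tent f).U → rc.SolidAt f z) ∧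
        Metric.ball y r ⊆ closure (⋃ j, polytope (HD f j)) ∪
          ((⋃ k ∈ (Finset.univ.filter fun k => fk k = f), (closure (polytope (HP k)) ∩ {z | rc.height k z ≤ -1})) ∪
            (⋃ k ∈ (Finset.univ.filter fun k => gk k = f), (closure (polytope (HP k)) ∩ {z | (rc.cell k).h + 1 ≤ rc.height k z})) ∪
            (⋃ l ∈ (Finset.univ.filter fun l => lab l = f), closure (polytope (HQ l))) ∪
            (⋃ r' ∈ (Finset.univ.filter fun r' => rc.rtL r' = f ∨ rc.rtR r' = f), closure (polytope (HB r'))) ∪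
            (⋃ g ∈ (Finset.univ.filter fun g => g ≠ f), {z | z ∈ closure (⋃ j, polytope (HD g j)) ∧
              (z ∈ (rc.tent g).U → rc.SolidAt g z) ∧
              ∃ r' : ℝ, 0 < r' ∧ rc.S f ∩ Metric.ball z (r' + 4) = rc.S g ∩ Metric.ball z (r' + 4)}))
  /-- stacking consistency of the cells with the grains' tents -/
  hS₁ : ∀ k, rigid (rc.cell k).M (rc.cell k).t '' stacking (rc.cell k).L₁ (rc.cell k).s₁ (rc.cell k).σ₁ = rc.S (fk k)
  hS₂ : ∀ k, rigid (rc.cell k).M (rc.cell k).t '' stacking (rc.cell k).L₂ (rc.cell k).s₂ (rc.cell k).σ₂ = rc.S (gk k)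
  /-- disjointness of territories, and of territories from the closed cells -/
  hDD : ∀ f g, f ≠ g → Disjoint (⋃ j, polytope (HD f j)) (⋃ j, polytope (HD g j))
  hDP : ∀ f k, Disjoint (⋃ j, polytope (HD f j)) (polytope (HP k))
  hPP : ∀ k k', k ≠ k' → Disjoint (polytope (HP k)) (polytope (HP k'))
  /-- which territories touch a cell, and where -/
  hside₁ : ∀ k, ∀ y ∈ closure (⋃ j, polytope (HD (fk k) j)) ∩ closure (polytope (HP k)), rc.height k y ≤ -R₀
  hside₂ : ∀ k, ∀ y ∈ closure (⋃ j, polytope (HD (gk k) j)) ∩ closure (polytope (HP k)), (rc.cell k).h + R₀ ≤ rc.height k y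
  hside₀ : ∀ k f, f ≠ fk k → f ≠ gk k → Disjoint (closure (⋃ j, polytope (HD f j))) (closure (polytope (HP k)))
  /-- agreement contacts between territories: free-zone parts solid, stackings coincide nearby -/
  hagree : ∀ f g, f ≠ g → ∀ y ∈ closure (⋃ j, polytope (HD f j)) ∩ closure (⋃ j, polytope (HD g j)),
    ∃ r : ℝ, 0 < r ∧ (∀ z ∈ Metric.ball y r, (z ∈ (rc.tent f).U → rc.SolidAt f z) ∧ (z ∈ (rc.tent g).U → rc.SolidAt g z)) ∧
      rc.S f ∩ Metric.ball y (r + 4) = rc.S g ∩ Metric.ball y (r + 4)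
  /-- the deep parts of a cell are WRAPPED in territory of the right grain (solid where it is free zone) -/
  hwrap₁ : ∀ k, ∀ y ∈ closure (polytope (HP k)), rc.height k y ≤ -R₀ → ∃ r : ℝ, 0 < r ∧
    Metric.ball y r ⊆ closure (polytope (HP k)) ∪ {z | z ∈ closure (⋃ j, polytope (HD (fk k) j)) ∧ (z ∈ (rc.tent (fk k)).U → rc.SolidAt (fk k) z)}
  hwrap₂ : ∀ k, ∀ y ∈ closure (polytope (HP k)), (rc.cell k).h + R₀ ≤ rc.height k y → ∃ r : ℝ, 0 < r ∧
    Metric.ball y r ⊆ closure (polytope (HP k)) ∪ {z | z ∈ closure (⋃ j, polytope (HD (gk k) j)) ∧ (z ∈ (rc.tent (gk k)).U → rc.SolidAt (gk k) z)}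
  /-- the cells' law tables are FULL -/
  hlaw : ∀ k i j, (¬ CoAx ((rc.cell k).A₁ i) ((rc.cell k).A₂ j) → (13 / 25 : ℝ) ≤ (rc.cell k).c i j) ∧
    (CoAx ((rc.cell k).A₁ i) ((rc.cell k).A₂ j) → (rc.cell k).A₁ i '' fccRef ≠ (rc.cell k).A₂ j '' fccRef →
      1 / 2 * Real.sqrt (1 - ⟪(rc.cell k).m i j, e₃⟫_ℝ ^ 2) ≤ (rc.cell k).c i j)
  /-- gap pieces: bounded open polytopes, disjoint from everything -/
  hQbd : ∀ l, Bornology.IsBounded (polytope (HQ l))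
  hQunit : ∀ l, ∀ p ∈ HQ l, ‖p.1‖ = 1
  hQD : ∀ l f, Disjoint (polytope (HQ l)) (⋃ j, polytope (HD f j))
  hQP : ∀ l k, Disjoint (polytope (HQ l)) (polytope (HP k))
  hQQ : ∀ l l', l ≠ l' → Disjoint (polytope (HQ l)) (polytope (HQ l'))
  /-- riser boxes: disjoint from territories, cells, gap pieces and each other -/
  hBD : ∀ r f, Disjoint (polytope (HB r)) (⋃ j, polytope (HD f j))
  hBP : ∀ r k, Disjoint (polytope (HB r)) (polytope (HP k))
  hBQ : ∀ r l, Disjoint (polytope (HB r)) (polytope (HQ l))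
  hBB : ∀ r r', r ≠ r' → Disjoint (polytope (HB r)) (polytope (HB r'))
  /-- riser boxes: the two column grains share one frame and origin (same layer planes), the piece's normal is that layer normal -/
  hframe : ∀ r, ∃ (L₀ : E3 ≃ₗᵢ[ℝ] E3) (s₀ : E3) (σL σR : ℤ → ℤ), IsHaggSeq σL ∧ IsHaggSeq σR ∧
    rc.S (rc.rtL r) = stacking L₀ s₀ σL ∧ rc.S (rc.rtR r) = stacking L₀ s₀ σR ∧ rc.rn r = L₀ e₃
  /-- riser boxes: every configuration ball in the closed box lies on one of the two stackings, and every such ball is owned by some riser piece -/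
  hBclean : ∀ r, ∀ q ∈ rc.X', q ∈ closure (polytope (HB r)) → q ∈ rc.S (rc.rtL r) ∪ rc.S (rc.rtR r)
  hBown : ∀ r, ∀ q ∈ rc.X', q ∈ closure (polytope (HB r)) → ∃ r', q ∈ rc.rown r'
  /-- riser pieces: the site sets ARE the in-plane stacking neighbours -/
  hBV : ∀ r, ∀ b ∈ rc.rown r, (b ∈ rc.S (rc.rtL r) → (↑(rc.rV r b) : Set E3) = {v | v ∈ rc.S (rc.rtL r) ∧ dist b v = 1 ∧ ⟪v - b, rc.rn r⟫_ℝ = 0}) ∧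
    (b ∈ rc.S (rc.rtR r) → (↑(rc.rV r b) : Set E3) = {v | v ∈ rc.S (rc.rtR r) ∧ dist b v = 1 ∧ ⟪v - b, rc.rn r⟫_ℝ = 0})
  /-- matching of the non-designated riser-box facets: a side whose stacking is complete nearby, and that side's material across -/
  hBmatch : ∀ r, ∀ p ∈ HB r \ desB r, ∀ y ∈ facetOf (HB r) p, ∃ ρ' : ℝ, 0 < ρ' ∧ ∃ g : Fin rc.ng, (g = rc.rtL r ∨ g = rc.rtR r) ∧
    rc.CompleteAt (rc.S g) (ρ' + 4) y ∧
    Metric.ball y ρ' ⊆ closure (polytope (HB r)) ∪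
      ((closure (⋃ j, polytope (HD g j))) ∪
        (⋃ k ∈ (Finset.univ.filter fun k => fk k = g), (closure (polytope (HP k)) ∩ {z | rc.height k z ≤ -1})) ∪
        (⋃ k ∈ (Finset.univ.filter fun k => gk k = g), (closure (polytope (HP k)) ∩ {z | (rc.cell k).h + 1 ≤ rc.height k z})) ∪
        (⋃ l ∈ (Finset.univ.filter fun l => lab l = g), closure (polytope (HQ l))) ∪
        (⋃ r' ∈ (Finset.univ.filter fun r' => r' ≠ r ∧ (rc.rtL r' = rc.rtL r ∧ rc.rtR r' = rc.rtR r ∨ rc.rtL r' = rc.rtR r ∧ rc.rtR r' = rc.rtL r)),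
          closure (polytope (HB r'))))
  /-- designated gap facets -/
  desQ : Fin nQ → Finset (E3 × ℝ)
  hdesQ : ∀ l, desQ l ⊆ HQ l
  /-- matching of the non-designated gap facets: the far side is material of the label (now including riser boxes carrying the label) -/
  hQmatch : ∀ l, ∀ p ∈ HQ l \ desQ l, ∀ y ∈ facetOf (HQ l) p, ∃ r : ℝ, 0 < r ∧
    Metric.ball y r ⊆ closure (polytope (HQ l)) ∪
      ((closure (⋃ j, polytope (HD (lab l) j))) ∪
        (⋃ k ∈ (Finset.univ.filter fun k => fk k = lab l), (closure (polytope (HP k)) ∩ {z | rc.height k z ≤ -1})) ∪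
        (⋃ k ∈ (Finset.univ.filter fun k => gk k = lab l), (closure (polytope (HP k)) ∩ {z | (rc.cell k).h + 1 ≤ rc.height k z})) ∪
        (⋃ l' ∈ (Finset.univ.filter fun l' => lab l' = lab l), closure (polytope (HQ l'))) ∪
        (⋃ r' ∈ (Finset.univ.filter fun r' => rc.rtL r' = lab l ∨ rc.rtR r' = lab l), closure (polytope (HB r'))) ∪
        (⋃ g ∈ (Finset.univ.filter fun g => g ≠ lab l), {z | z ∈ closure (⋃ j, polytope (HD g j)) ∧ (z ∈ (rc.tent g).U → rc.SolidAt g z) ∧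
          ∃ r' : ℝ, 0 < r' ∧ rc.S (lab l) ∩ Metric.ball z (r' + 4) = rc.S g ∩ Metric.ball z (r' + 4)}))
  /-- the gap budget: designated facets of gap pieces, territories and riser boxes -/
  gapArea : ℝ
  hgapArea : (∑ l, ∑ p ∈ desQ l, facetArea (facetOf (HQ l) p) p.1) +
      (∑ f, ∑ j, ∑ p ∈ desD f j, facetArea (facetOf (HD f j) p) p.1) +
      (∑ r, ∑ p ∈ desB r, facetArea (facetOf (HB r) p) p.1) ≤ gapArea
  /-- RELAXED mass: at least `(1 − δ)N` balls are deep in a territory (tent-deep, or away from the free zone and locally perfect) or a cell half -/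
  hmass : (1 - δ) * (N : ℝ) ≤
    ((Finset.univ.filter fun i : Fin rc.N' => ∃ f,
      (rc.DeepAt f (rc.x' i) ∨ (Disjoint (Metric.closedBall (rc.x' i) (Real.sqrt 2)) (rc.tent f).U ∧ rc.LocPerfect (rc.x' i))) ∧
      Metric.closedBall (rc.x' i) (Real.sqrt 2) ⊆ (⋃ j, polytope (HD f j)) ∪
        (⋃ k ∈ (Finset.univ.filter fun k => fk k = f), (closure (polytope (HP k)) ∩ {z | rc.height k z ≤ -1})) ∪
        (⋃ k ∈ (Finset.univ.filter fun k => gk k = f), (closure (polytope (HP k)) ∩ {z | (rc.cell k).h + 1 ≤ rc.height k z}))).card : ℝ)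

namespace Mesh₃

variable {C R₀ : ℝ} {N : ℕ} {x : Fin N → E3} {rc : RiseredCover C R₀ N x} {δ : ℝ}

/-- the territory of grain `f` -/
def D (μ : Mesh₃ rc δ) (f : Fin rc.ng) : Set E3 := ⋃ j, polytope (μ.HD f j)

/-- the fiat-solid core of grain `f` -/
def Core (μ : Mesh₃ rc δ) (f : Fin rc.ng) : Set E3 := ⋃ j, polytope (μ.HC f j)

/-- the prism texture-cell of wall cell `k` -/
def P (μ : Mesh₃ rc δ) (k : Fin rc.nk) : Set E3 := polytope (μ.HP k)

/-- the gap piece `l` -/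
def Q (μ : Mesh₃ rc δ) (l : Fin μ.nQ) : Set E3 := polytope (μ.HQ l)

/-- the riser box `r` -/
def B (μ : Mesh₃ rc δ) (r : Fin rc.nr) : Set E3 := polytope (μ.HB r)

/-- the GAP COST v3: designated facets (gap pieces, territories, riser boxes) and prism laterals times the support bound `3`, plus the prisms'
slice excess at the maximal charge `13/25`. -/
def gapCost (μ : Mesh₃ rc δ) : ℝ := 3 * (μ.gapArea + ∑ k, μ.latArea k) + 13 / 25 * ∑ k, μ.ex k

end Mesh₃

/-! ## The level-2 composition of record (mesh v3, slack form) -/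

/-- **THE LEVEL-2 COMPOSITION over risered cover + mesh v3, WITH SLACK** (adhesion hypothesis arbitrary): «TB-cover v3» + «TB-energy v3» + the wall law
⇒ the atomic-scale saturated shadow theorem.  `energy ≤ tent + charge + riser + gap ≤ Def − slack + tilingLoss₂ + rimSum + gap ≤ Def + θN^{2/3}`. -/
theorem shadowTheoremSatAtomicV5_of_risered₃_slack {Adh : Prop}
    (hcover : BarlowResolution → Adh →
      ∀ C R₀ : ℝ, 1 ≤ R₀ → ∀ K δ θ : ℝ, 0 < δ → 0 < θ → ∃ N₀ : ℕ, ∀ N : ℕ, N₀ ≤ N → ∀ x : Fin N → E3, IsUnitPacking x →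
        IsSaturated x → 6 * (N : ℝ) - (numContacts x : ℝ) ≤ K * (N : ℝ) ^ ((2 : ℝ) / 3) →
        ∃ (rc : RiseredCover C R₀ N x) (μ : Mesh₃ rc δ),
          rc.tilingLoss₂ + rc.rimSum + μ.gapCost ≤ θ * (N : ℝ) ^ ((2 : ℝ) / 3) + rc.unownedSlack₃)
    (henergy : PolytopeCalculus → BarlowFreeCertificate →
      ∀ (C R₀ : ℝ) (N : ℕ) (x : Fin N → E3) (δ : ℝ) (rc : RiseredCover C R₀ N x) (μ : Mesh₃ rc δ),
        ∃ (n : ℕ) (G : Fin n → Set E3) (A : Fin n → (E3 ≃ₗᵢ[ℝ] E3)) (c : Fin n → Fin n → ℝ) (m : Fin n → Fin n → E3),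
          IsTexture (13 / 25) (1 / 2) n G A c m ∧ (1 - δ) * (N : ℝ) ≤ Real.sqrt 2 * vol n G ∧
          energy n G A c m ≤ rc.tentBudget + rc.chargeSum + rc.riserSum + μ.gapCost) :
    BarlowResolution → Adh → BilayerWallV5 → PolytopeCalculus → BarlowFreeCertificate → ShadowTheoremSatAtomicV5 := by
  intro hres hadh hBW hpoly hfree _hG _hC _hNRG _hSL K δ θ hδ hθ
  obtain ⟨C, R₀, hR₀, hW⟩ := hBW
  obtain ⟨N₀, hN₀⟩ := hcover hres hadh C R₀ hR₀ K δ θ hδ hθ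
  refine ⟨N₀, fun N hN x hx hsat hK => ?_⟩
  obtain ⟨rc, μ, hslack⟩ := hN₀ N hN x hx hsat hK
  obtain ⟨n, G, A, c, m, hT, hvol, hEn⟩ := henergy hpoly hfree C R₀ N x δ rc μ
  refine ⟨n, G, A, c, m, hT, hvol, ?_⟩
  have hdisc := rc.tentBudget_add_chargeSum_le₃_slack hR₀ hW
  linarith

/-- **THE v8.8 COMPOSITION OF RECORD (mesh v3)**: TB-cover v3 (T-form adhesion, slack target) + TB-energy v3 ⇒ the registered shape of `stub_textureBuild`. -/
theorem textureBuildR₃_of_stubs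
    (hcover : BarlowResolution → BarlowAdhesionT →
      ∀ C R₀ : ℝ, 1 ≤ R₀ → ∀ K δ θ : ℝ, 0 < δ → 0 < θ → ∃ N₀ : ℕ, ∀ N : ℕ, N₀ ≤ N → ∀ x : Fin N → E3, IsUnitPacking x →
        IsSaturated x → 6 * (N : ℝ) - (numContacts x : ℝ) ≤ K * (N : ℝ) ^ ((2 : ℝ) / 3) →
        ∃ (rc : RiseredCover C R₀ N x) (μ : Mesh₃ rc δ),
          rc.tilingLoss₂ + rc.rimSum + μ.gapCost ≤ θ * (N : ℝ) ^ ((2 : ℝ) / 3) + rc.unownedSlack₃)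
    (henergy : PolytopeCalculus → BarlowFreeCertificate →
      ∀ (C R₀ : ℝ) (N : ℕ) (x : Fin N → E3) (δ : ℝ) (rc : RiseredCover C R₀ N x) (μ : Mesh₃ rc δ),
        ∃ (n : ℕ) (G : Fin n → Set E3) (A : Fin n → (E3 ≃ₗᵢ[ℝ] E3)) (c : Fin n → Fin n → ℝ) (m : Fin n → Fin n → E3),
          IsTexture (13 / 25) (1 / 2) n G A c m ∧ (1 - δ) * (N : ℝ) ≤ Real.sqrt 2 * vol n G ∧
          energy n G A c m ≤ rc.tentBudget + rc.chargeSum + rc.riserSum + μ.gapCost) :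
    BarlowResolution → BarlowAdhesionT → BilayerWallV5 → PolytopeCalculus → BarlowFreeCertificate → ShadowTheoremSatV5 :=
  textureBuild_of_atomic (shadowTheoremSatAtomicV5_of_risered₃_slack hcover henergy)

end Summit.Ventures.Crystal3D.Cruxes.TextureLiminf.TexShadow

end
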